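/-
Copyright (c) 2026 the pub-hodgecm-mathlib formalisation cell (harness21).  Prover seat hodgecm-mathlib-K2Liu-p05 (g4), 2026-09-04
(Track B «K2-LIT», crux hLiu418 = stmt-HodgeConjecture-24832, LEAD F0P6-plan (g13) RULING M-157m (1) organ (SD-1-ind), file (III):
a `K_w`-finite Siegel section at the Weyl translate is a POLYNOMIAL in the entries of `(1 ± i b)⁻¹` times the modulus character).
-/
import Summits.HodgeConjecture.HodgeConjecture.Theorems.K2LiuWeylTranslateIwasawa                      -- ★ (SD-1-ind) (I): `J · transl b = p(b) k(b)`
import Summits.HodgeConjecture.HodgeConjecture.Theorems.K2LiuCompactUnitaryFiniteFunctionsPolynomial    -- ★ (K∞-str) F2: `eval_bind₁`, the F2 face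
import HarnessLib

/-!
# (SD-1-ind, III) A `K_w`-finite Siegel section at the Weyl translate: `f (J · transl b) = χ(det a)‖det a‖^{2s+l} · Q(entries of c, entries of a)`

Track B ∕ K2-LIT, hLiu418 = stmt-HodgeConjecture-24832; LEAD F0P6-plan (g13) RULING M-157m (1) «(SD-1-ind): for a `K_∞`-finite flat section of `I_σ(s)`,
`f|_{K_∞}` polynomial in `k, k̄` (★ F2) ⇒ `f_s(w·n(b)) = Σ_j P_j((1−ib)⁻¹, (1+ib)⁻¹ entries)·(modulus)`».  Namespace
`Summit.HodgeConjecture.HodgeConjecture.Cruxes.HLiu418.K2LiuKFiniteSectionAtWeylTranslate`.  THEOREMS ONLY (no definition, no instance, no notation,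
no named fact, no `sorry`); `--supports stmt-HodgeConjecture-24832 --as helper`.

THE STATEMENT (`exists_mvPolynomial_section_J_mul_transl`).  Let `f` be a Siegel section of `I_w(s, χ)` (★ `IsArchSiegelSection χ s f`, K2Liu-p11 (g0)'s tube
frame) whose restriction to the stabiliser `K_w = {u ∈ U(J) : u · i1 = i1}` (`K_w ⊂ U(2l)`, (SD-1-ind) (II)) is a polynomial in the matrix entries `u_{pq}` and
their conjugates — the (K∞-str) face ★ `exists_mvPolynomial_of_finiteDimensional_span_rightTranslates` of a `K_w`-FINITE continuous `f|_{K_w}`, taken here BY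
VALUE as the hypothesis `hF2`.  Then there is ONE polynomial `Q ∈ ℂ[X_{ij}, Y_{ij}]` with, for every hermitian `b`, writing `c = (1 + ib)⁻¹`, `a = (1 − ib)⁻¹ = cᴴ`,
  `f (J · transl b) = χ(det a) · ‖det a‖^{2s + l} · Q(c_{ij}, a_{ij})`.
PROOF. ★ (I) `section_J_mul_transl`: `f (J · transl b) = χ(det a)‖det a‖^{2s+l} f (k(b))` with `k(b) = (b c, −c; c, c b) ∈ K_w`; the entries of `k(b)` are AFFINE in
the entries of `c` (`b c = c b = −i(1 − c)`, `stabFactor_eq_affine`) and the entries of `k(b)̄` are affine in those of `a` (`k(b)ᴴ = (i(1 − a), a; −a, i(1 − a))`,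
`conjTranspose_stabFactor_eq_affine`), so `Q = bind₁ (affine substitution) P` (`eval_bind₁`).
SEQUEL (IV)–(V) (M-157m): for `χ = χ_k`, `χ_k(det a)‖det a‖^{2s+l} = det(1 − ib)^{−α} det(1 + ib)^{−β}`, `(α, β) = s + l∕2 ∓ k∕2`, and each monomial in `c, a`
is a `t`-derivative at `0` of `det(1 ± ib + tΞ)^{−α∓…}` (resolvent algebra + ★ polarization `K2LiuPolyGaussianPolarization`), giving `W_h(s; f)` as a finite
combination of `(d∕dt)^d xiShift (½·1 + t•Ξ) (π h) α β |_{t=0}`.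

HONEST LABEL: HC_CM is proved only modulo the 7 printed citations (2 remaining named inputs: hLiu418 = stmt-HodgeConjecture-24832, h413 =
stmt-HodgeConjecture-24833) until rung 0 closes; organ capital, moves no counter.

## References
[Shimura1997] G. Shimura, *Euler Products and Eisenstein Series*, CBMS 93 (1997), §16 (the Weyl translate of a section under the parabolic law) ·
[WallachRRG1] N. Wallach, *Real Reductive Groups I*, §3 (K-finite vectors of induced representations; matrix coefficients of compact groups are polynomial).
-/

set_option autoImplicit false
set_option linter.dupNamespace false

noncomputable section

open scoped Matrix ComplexConjugate ComplexOrder MatrixOrder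
open Complex Matrix
open Literature.NumberTheory.ModularForms.SiegelUpperHalfSpace (moeb)
open Summit.HodgeConjecture.HodgeConjecture.Cruxes.HLiu418.K2LiuHermitianTubeCocycle
open Summit.HodgeConjecture.HodgeConjecture.Cruxes.HLiu418.K2LiuWeylTranslateIwasawa
open Summit.HodgeConjecture.HodgeConjecture.Cruxes.HLiu418.K2LiuCompactGroupFiniteFunctions (eval_bind₁)

namespace Summit.HodgeConjecture.HodgeConjecture.Cruxes.HLiu418.K2LiuKFiniteSectionAtWeylTranslate

variable {l : Type*} [Fintype l] [DecidableEq l]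

/-! ## §1 The entries of the stabiliser factor are affine in the entries of `c = (1 + ib)⁻¹`, those of its conjugate in the entries of `a = (1 − ib)⁻¹` -/

/-- `(1 + ib) c = 1` for `c = (1 + ib)⁻¹`, `b` hermitian. [folklore] -/
theorem one_add_I_smul_mul_inv {b : Matrix l l ℂ} (hb : bᴴ = b) : (1 + I • b) * (1 + I • b)⁻¹ = 1 :=
  mul_nonsing_inv _ (isUnit_det_one_add_I_smul hb)

/-- `c (1 + ib) = 1`. [folklore] -/
theorem inv_mul_one_add_I_smul {b : Matrix l l ℂ} (hb : bᴴ = b) : (1 + I • b)⁻¹ * (1 + I • b) = 1 :=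
  nonsing_inv_mul _ (isUnit_det_one_add_I_smul hb)

/-- `a (1 − ib) = 1` for `a = (1 − ib)⁻¹`. [folklore] -/
theorem inv_mul_one_sub_I_smul {b : Matrix l l ℂ} (hb : bᴴ = b) : (1 - I • b)⁻¹ * (1 - I • b) = 1 :=
  nonsing_inv_mul _ (isUnit_det_one_sub_I_smul hb)

/-- **`b c = −i(1 − c)`**: the `(1,1)` block of `k(b)` is affine in `c`. [folklore] -/
theorem mul_inv_one_add_I_smul_eq {b : Matrix l l ℂ} (hb : bᴴ = b) : b * (1 + I • b)⁻¹ = (-I) • (1 - (1 + I • b)⁻¹) := by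
  have h : (1 + I • b)⁻¹ + I • (b * (1 + I • b)⁻¹) = 1 := by
    have := one_add_I_smul_mul_inv hb
    rwa [add_mul, Matrix.one_mul, Matrix.smul_mul] at this
  have h' : I • (b * (1 + I • b)⁻¹) = 1 - (1 + I • b)⁻¹ := eq_sub_of_add_eq' h
  rw [← h', smul_smul, neg_mul, I_mul_I, neg_neg, one_smul]

/-- **`c b = b c`**. [folklore] -/
theorem inv_one_add_I_smul_mul_comm {b : Matrix l l ℂ} (hb : bᴴ = b) : (1 + I • b)⁻¹ * b = b * (1 + I • b)⁻¹ := by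
  rw [inv_one_add_I_smul hb, ← mul_letter_comm hb]

/-- **`a b = i(1 − a)`**: the conjugate blocks are affine in `a`. [folklore] -/
theorem inv_one_sub_I_smul_mul_eq {b : Matrix l l ℂ} (hb : bᴴ = b) : (1 - I • b)⁻¹ * b = I • (1 - (1 - I • b)⁻¹) := by
  have h : (1 - I • b)⁻¹ - I • ((1 - I • b)⁻¹ * b) = 1 := by
    have := inv_mul_one_sub_I_smul hb
    rwa [mul_sub, Matrix.mul_one, Matrix.mul_smul] at this
  have h' : I • ((1 - I • b)⁻¹ * b) = (1 - I • b)⁻¹ - 1 := eq_sub_of_add_eq (sub_eq_iff_eq_add'.1 h).symm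
  calc (1 - I • b)⁻¹ * b = (-I) • (I • ((1 - I • b)⁻¹ * b)) := by rw [smul_smul, neg_mul, I_mul_I, neg_neg, one_smul]
    _ = I • (1 - (1 - I • b)⁻¹) := by rw [h', ← neg_sub 1 (1 - I • b)⁻¹, smul_neg, neg_smul, neg_neg]

/-- `cᴴ = a`: `((1 + ib)⁻¹)ᴴ = (1 − ib)⁻¹`. [folklore] -/
theorem conjTranspose_inv_one_add_I_smul {b : Matrix l l ℂ} (hb : bᴴ = b) : ((1 + I • b)⁻¹)ᴴ = (1 - I • b)⁻¹ := by
  rw [conjTranspose_nonsing_inv, conjTranspose_one_add_I_smul hb]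

/-- **the stabiliser factor with affine entries**: `k(b) = (−i(1 − c), −c; c, −i(1 − c))`, `c = (1 + ib)⁻¹`. [cite: Shimura1997, §16.4] -/
theorem stabFactor_eq_affine {b : Matrix l l ℂ} (hb : bᴴ = b) :
    (fromBlocks (b * ((1 - I • b) * (1 + b * b)⁻¹)) (-((1 - I • b) * (1 + b * b)⁻¹)) ((1 - I • b) * (1 + b * b)⁻¹)
        ((1 - I • b) * (1 + b * b)⁻¹ * b) : Matrix (l ⊕ l) (l ⊕ l) ℂ) =
      fromBlocks ((-I) • (1 - (1 + I • b)⁻¹)) (-(1 + I • b)⁻¹) (1 + I • b)⁻¹ ((-I) • (1 - (1 + I • b)⁻¹)) := by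
  rw [← inv_one_add_I_smul hb, inv_one_add_I_smul_mul_comm hb, mul_inv_one_add_I_smul_eq hb]

/-- **its conjugate transpose with affine entries**: `k(b)ᴴ = (i(1 − a), a; −a, i(1 − a))`, `a = (1 − ib)⁻¹ = cᴴ`. [cite: Shimura1997, §16.4] -/
theorem conjTranspose_stabFactor_eq_affine {b : Matrix l l ℂ} (hb : bᴴ = b) :
    (fromBlocks (b * ((1 - I • b) * (1 + b * b)⁻¹)) (-((1 - I • b) * (1 + b * b)⁻¹)) ((1 - I • b) * (1 + b * b)⁻¹)
        ((1 - I • b) * (1 + b * b)⁻¹ * b) : Matrix (l ⊕ l) (l ⊕ l) ℂ)ᴴ =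
      fromBlocks (I • (1 - (1 - I • b)⁻¹)) (1 - I • b)⁻¹ (-(1 - I • b)⁻¹) (I • (1 - (1 - I • b)⁻¹)) := by
  have hA : ((-I) • (1 - (1 + I • b)⁻¹) : Matrix l l ℂ)ᴴ = I • (1 - (1 - I • b)⁻¹) := by
    rw [conjTranspose_smul, conjTranspose_sub, conjTranspose_one, conjTranspose_inv_one_add_I_smul hb, star_neg, star_def, conj_I, neg_neg]
  rw [stabFactor_eq_affine hb, fromBlocks_conjTranspose, hA, conjTranspose_neg, conjTranspose_inv_one_add_I_smul hb]

/-! ## §2 The integrand identity -/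

/-- **A `K_w`-FINITE SIEGEL SECTION AT THE WEYL TRANSLATE.**  If `f` is a Siegel section of `I_w(s, χ)` whose restriction to the stabiliser
`K_w = U(J) ∩ Stab(i1)` is a polynomial in the matrix entries and their conjugates (the (K∞-str) face of `K_w`-finiteness, BY VALUE), then ONE polynomial
`Q ∈ ℂ[X_{ij}, Y_{ij}]` gives, for every hermitian `b`, `f (J · transl b) = χ(det (1 − ib)⁻¹) · ‖det (1 − ib)⁻¹‖^{2s + l} · Q((1 + ib)⁻¹_{ij}, (1 − ib)⁻¹_{ij})`.
[cite: Shimura1997, §16.4] [cite: WallachRRG1, §3.3] -/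
theorem exists_mvPolynomial_section_J_mul_transl {χ : ℂ → ℂ} {s : ℂ} {f : Matrix (l ⊕ l) (l ⊕ l) ℂ → ℂ}
    (hf : K2LiuArchInducedTubeDefs.IsArchSiegelSection χ s f)
    (hF2 : ∃ P : MvPolynomial (((l ⊕ l) × (l ⊕ l)) ⊕ ((l ⊕ l) × (l ⊕ l))) ℂ, ∀ u : Matrix (l ⊕ l) (l ⊕ l) ℂ,
      uᴴ * Matrix.J l ℂ * u = Matrix.J l ℂ → moeb u (I • (1 : Matrix l l ℂ)) = I • 1 →
        f u = MvPolynomial.eval (Sum.elim (fun pq : (l ⊕ l) × (l ⊕ l) => u pq.1 pq.2) (fun pq : (l ⊕ l) × (l ⊕ l) => conj (u pq.1 pq.2))) P) :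
    ∃ Q : MvPolynomial ((l × l) ⊕ (l × l)) ℂ, ∀ b : Matrix l l ℂ, bᴴ = b →
      f (Matrix.J l ℂ * fromBlocks 1 b 0 1) =
        χ (1 - I • b)⁻¹.det * (((‖(1 - I • b)⁻¹.det‖ : ℝ) : ℂ) ^ (2 * s + (Fintype.card l : ℂ))) *
          MvPolynomial.eval (Sum.elim (fun ij : l × l => (1 + I • b)⁻¹ ij.1 ij.2) (fun ij : l × l => (1 - I • b)⁻¹ ij.1 ij.2)) Q := by
  classical
  obtain ⟨P, hP⟩ := hF2
  -- the affine substitution: `X_{ij} ↦ c_{ij}`, `Y_{ij} ↦ a_{ij}`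
  let δ : l → l → MvPolynomial ((l × l) ⊕ (l × l)) ℂ := fun i j => MvPolynomial.C ((1 : Matrix l l ℂ) i j)
  let g : (((l ⊕ l) × (l ⊕ l)) ⊕ ((l ⊕ l) × (l ⊕ l))) → MvPolynomial ((l × l) ⊕ (l × l)) ℂ :=
    Sum.elim
      (fun pq => Sum.elim
        (fun i => Sum.elim (fun j => MvPolynomial.C (-I) * (δ i j - MvPolynomial.X (Sum.inl (i, j))))
          (fun j => -MvPolynomial.X (Sum.inl (i, j))) pq.2)
        (fun i => Sum.elim (fun j => MvPolynomial.X (Sum.inl (i, j)))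
          (fun j => MvPolynomial.C (-I) * (δ i j - MvPolynomial.X (Sum.inl (i, j)))) pq.2) pq.1)
      (fun pq => Sum.elim
        (fun i => Sum.elim (fun j => MvPolynomial.C I * (δ j i - MvPolynomial.X (Sum.inr (j, i))))
          (fun j => -MvPolynomial.X (Sum.inr (j, i))) pq.2)
        (fun i => Sum.elim (fun j => MvPolynomial.X (Sum.inr (j, i)))
          (fun j => MvPolynomial.C I * (δ j i - MvPolynomial.X (Sum.inr (j, i)))) pq.2) pq.1)
  refine ⟨MvPolynomial.bind₁ g P, fun b hb => ?_⟩
  rw [section_J_mul_transl hf hb, hP _ (stabFactor_mem hb) (moeb_stabFactor_I hb), eval_bind₁]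
  congr 2
  refine congrArg MvPolynomial.eval (funext fun v => ?_)
  have hconj : ∀ p q : l ⊕ l,
      conj ((fromBlocks (b * ((1 - I • b) * (1 + b * b)⁻¹)) (-((1 - I • b) * (1 + b * b)⁻¹)) ((1 - I • b) * (1 + b * b)⁻¹)
        ((1 - I • b) * (1 + b * b)⁻¹ * b) : Matrix (l ⊕ l) (l ⊕ l) ℂ) p q) =
        (fromBlocks (I • (1 - (1 - I • b)⁻¹)) (1 - I • b)⁻¹ (-(1 - I • b)⁻¹) (I • (1 - (1 - I • b)⁻¹)) : Matrix (l ⊕ l) (l ⊕ l) ℂ) q p := by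
    intro p q
    rw [← conjTranspose_stabFactor_eq_affine hb, conjTranspose_apply, star_def]
  rcases v with ⟨p, q⟩ | ⟨p, q⟩
  · simp only [Sum.elim_inl]
    rw [stabFactor_eq_affine hb]
    rcases p with i | i <;> rcases q with j | j <;>
      simp only [g, δ, Sum.elim_inl, Sum.elim_inr, fromBlocks_apply₁₁, fromBlocks_apply₁₂, fromBlocks_apply₂₁, fromBlocks_apply₂₂,
        Matrix.smul_apply, Matrix.sub_apply, Matrix.neg_apply, smul_eq_mul, map_mul, map_sub, map_neg, MvPolynomial.eval_C, MvPolynomial.eval_X]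
  · simp only [Sum.elim_inr]
    rw [hconj]
    rcases p with i | i <;> rcases q with j | j <;>
      simp only [g, δ, Sum.elim_inl, Sum.elim_inr, fromBlocks_apply₁₁, fromBlocks_apply₁₂, fromBlocks_apply₂₁, fromBlocks_apply₂₂,
        Matrix.smul_apply, Matrix.sub_apply, Matrix.neg_apply, smul_eq_mul, map_mul, map_sub, map_neg, MvPolynomial.eval_C, MvPolynomial.eval_X]

end Summit.HodgeConjecture.HodgeConjecture.Cruxes.HLiu418.K2LiuKFiniteSectionAtWeylTranslate

end
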